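import Summits.QuantumAdvantage.QuantumAdvantage.Theorems.WhiteBoxWalkDefs
import Literature.Computability.Complexity.CodeFPStrings
import Literature.Computability.Complexity.CodeFPModArith
import Literature.Computability.Complexity.ListFoldChecks

/-!
# Route `WhiteBoxWalk`, crux `WbwThesis` (stmt-QuantumAdvantage-2238), line `Sketch`: extracting the product

`stub_extract`: a polynomial-time string function `h` maps the instance `genPQ w` to the numeral
`encodeNat (bigProd w)` of the product of the hard-block semiprimes.

THE FORMAT. With `n = nOf |w|`, `t = t(n)`, `x_j = blk n j w` (`j < t`, all of length `n` since
`n t ≤ |w|`, `Yao.M_nOf_le`): `genPQ w = frames (comps ++ [sfx])` where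
`comps = [pad n (fPQ x_0), …, pad n (fPQ x_{t-1})]`, `sfx = w ⇂ (n t)`, and `frames = encList = rawE strE`
(`frames_eq_encList`), i.e. `genPQ w` is the raw-list code of `t + 1` STRINGS. Since `p = X + 1` and
`|fPQ x_j| = n + 1`, `pad n (fPQ x_j) = fPQ x_j ++ [1]`: a hard item is `1 · encW n (P Q) · 1`, an easy
item is `0 · x_j · 1`; the last item (the suffix) is dropped BY POSITION.

THE PROGRAM (typed layer `CodeFP`, Arora–Barak §1.3): on a raw list `L` of strings compute
`((L ↾ (|L| - 1)).map val).prod` with `val s = if s[0] then ⟦(s ⇂ 1) ↾ (|s| - 2)⟧ else 1`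
(`Extract.extract_codeFP`: `ulength`, `rawTakeUn`, `map₀`, `strGetD`/`strDrop`/`strTake`/`strVal`,
`ite`, and the product fold — a `foldl₀` of `natMul` whose accumulator numeral is at most one symbol
longer than the list code, `prod_lt_two_pow_length_rawE_succ`). On `genPQ w` the kept
items are exactly `comps`, `val (pad n (fPQ x_j)) = if isPrimePair x_j then P_j Q_j else 1`
(`Extract.val_pad_fPQ`: the width-`n` numeral is exact as `P_j Q_j < 2^{2⌊n/2⌋} ≤ 2ⁿ`), and the product
is `bigProd w` by definition. For `|w| < 64` (`n = t = 0`) the list is `[w]`, nothing is kept, and the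
empty product `1 = bigProd w` comes out.

References: S. Arora, B. Barak, *Computational Complexity* (2009), §1.3 (closure of polynomial time
under composition and polynomially bounded loops); O. Goldreich, *Foundations of Cryptography I*
(2001), §2.3.1 (the direct-product format).
-/

noncomputable section

set_option linter.dupNamespace false -- D-0017: single-problem summit ⇒ `QuantumAdvantage.QuantumAdvantage` by design

namespace Summit.QuantumAdvantage.QuantumAdvantage.Theorems.WhiteBoxWalk

open Literature.Computability.Cryptography Literature.Computability.Complexity
open _root_.Computability Polynomial
open Literature.Computability.Complexity.CodeFP

namespace Extract

/-! ### The typed program -/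

/-- Subtracting a constant in unary: `1ᵐ ↦ 1^{m - k}` (drop `k` symbols). [folklore] -/
theorem unSubConst (k : ℕ) : CodeFP unE unE (fun m => m - k) :=
  (strDrop.comp ((const unE k).pair strOfUn)).recodeOut fun m => by
    show (unE m).drop k = unE (m - k)
    rw [unE_eq_ones, unE_eq_ones]
    exact List.drop_replicate

/-- **The value of an item**: `val s = if s[0] then ⟦(s ⇂ 1) ↾ (|s| - 2)⟧ else 1` is polynomial time.
[Arora–Barak 2009, §1.3] -/
theorem val_codeFP : CodeFP strE natE
    (fun s => if s.getD 0 false then bitsToNat ((s.drop 1).take (s.length - 2)) else 1) := by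
  have hcond : CodeFP strE bitE (fun s => s.getD 0 false) :=
    (strGetD.comp ((const strE 0).pair (CodeFP.id strE)) :)
  have hbody : CodeFP strE natE (fun s => bitsToNat ((s.drop 1).take (s.length - 2))) :=
    (strVal.comp (strTake.comp (((unSubConst 2).comp strLength).pair
      (strDrop.comp ((const strE 1).pair (CodeFP.id strE))))) :)
  exact hcond.ite hbody (const strE 1)

/-- **The extraction program**: `L ↦ ((L ↾ (|L| - 1)).map val).prod` on raw lists of strings is
polynomial time; the product of a raw list of numerals is a `foldl₀` of `natMul` whose accumulator
`∏ l₁` has a numeral at most one symbol longer than the code of `l₁` (`prod_lt_two_pow_length_rawE_succ`;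
the same fold as `SimApproxLLL.prodFP` / `Brick.prodListFn`). [Arora–Barak 2009, §1.3] -/
theorem extract_codeFP : CodeFP (rawE strE) natE (fun L => ((L.take (L.length - 1)).map
    fun s => if s.getD 0 false then bitsToNat ((s.drop 1).take (s.length - 2)) else 1).prod) := by
  -- adapted from `VanDamSeroussiOracleFP.codeFP_listProd` (private there)
  have hfold := foldl₀ (eα := natE) (eβ := natE) (step := fun (a : ℕ) (b : ℕ) => b * a) (b₀ := 1)
    (natMul.comp ((snd _ _).pair (fst _ _))) (X + 1) (fun l₁ l₂ => by
      rw [eval_add, eval_X, eval_one, ← List.prod_eq_foldl]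
      refine (length_natE_le_of_lt (prod_lt_two_pow_length_rawE_succ l₁)).trans ?_
      have := length_rawE_le_of_sublist natE (List.sublist_append_left l₁ l₂)
      omega)
  have listProd : CodeFP (rawE natE) natE List.prod := hfold.congr fun l => by rw [← List.prod_eq_foldl]
  exact (listProd.comp ((map₀ val_codeFP).comp ((rawTakeUn strE).comp
    (((unSubConst 1).comp (ulength strE)).pair (CodeFP.id (rawE strE))))) :)

/-! ### The format of `genPQ w` -/

/-- `genPQ w` is the raw-list code of the padded block images followed by the suffix. [folklore] -/
theorem genPQ_eq_rawE (w : List Bool) :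
    genPQ w = rawE strE (pqParams.comps (pqParams.nOf w.length) (pqParams.T (pqParams.nOf w.length)) w ++
      [w.drop (pqParams.nOf w.length * pqParams.T (pqParams.nOf w.length))]) := by
  show frames _ = encList (List.map strE _)
  rw [Brick.frames_eq_encList]
  simp [strE]

/-- With `p = X + 1` the padding of an `fPQ`-image of a length-`n` block is one symbol:
`pad n (fPQ x) = fPQ x ++ [1]`. [folklore] -/
theorem pad_fPQ (x : List Bool) : pqParams.pad x.length (fPQ x) = fPQ x ++ [true] := by
  simp [Yao.Params.pad]

/-- The semiprime of a block is below `2^{|x|}` (both halves are `⌊|x|/2⌋`-bit numbers). [folklore] -/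
theorem pOf_mul_qOf_lt (x : List Bool) : pOf x * qOf x < 2 ^ x.length := by
  have hp : pOf x < 2 ^ (x.length / 2) :=
    (bitsToNat_lt _).trans_le (Nat.pow_le_pow_right Nat.two_pos (by simp))
  have hq : qOf x < 2 ^ (x.length / 2) :=
    (bitsToNat_lt _).trans_le (Nat.pow_le_pow_right Nat.two_pos (by simp))
  calc pOf x * qOf x < 2 ^ (x.length / 2) * 2 ^ (x.length / 2) :=
        mul_lt_mul'' hp hq (Nat.zero_le _) (Nat.zero_le _)
    _ = 2 ^ (x.length / 2 + x.length / 2) := (pow_add _ _ _).symm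
    _ ≤ 2 ^ x.length := Nat.pow_le_pow_right Nat.two_pos (by omega)

/-- **The value of a kept item**: `val (pad |x| (fPQ x)) = if isPrimePair x then P Q else 1`. [folklore] -/
theorem val_pad_fPQ {n : ℕ} (x : List Bool) (hx : x.length = n) :
    (if (pqParams.pad n (fPQ x)).getD 0 false then
        bitsToNat (((pqParams.pad n (fPQ x)).drop 1).take ((pqParams.pad n (fPQ x)).length - 2))
      else 1) = if isPrimePair x then pOf x * qOf x else 1 := by
  subst hx
  rw [pad_fPQ]
  unfold fPQ
  cases isPrimePair x
  · simp
  · simp only [ite_true, List.cons_append, List.getD_cons_zero, List.drop_succ_cons, List.drop_zero,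
      List.length_cons, List.length_append, length_encW, List.length_nil, Nat.zero_add]
    rw [show x.length + 1 + 1 - 2 = x.length by omega, List.take_left' (length_encW _ _)]
    -- the width-`|x|` numeral is exact (cf. `Canon.bitsToNat_encW`): `|encodeNat (P Q)| ≤ |x|`
    have hl : (encodeNat (pOf x * qOf x)).length ≤ x.length := length_natE_le_of_lt (pOf_mul_qOf_lt x)
    rw [encW, List.take_of_length_le hl, bitsToNat_append, bitsToNat_replicate_false, Nat.mul_zero,
      Nat.add_zero, bitsToNat_encodeNat]

end Extract

/-- **`stub_extract`** (quantum side, pre-processing): a polynomial-time string function maps the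
instance `genPQ w` to the numeral of `bigProd w`, the product of the hard-block semiprimes — the typed
program `Extract.extract_codeFP` run on the raw-list format of `genPQ w`. [Arora–Barak 2009, §1.3] -/
theorem stub_extract : ∃ h : List Bool → List Bool, h ∈ FP ∧ ∀ w, h (genPQ w) = encodeNat (bigProd w) := by
  obtain ⟨F, hF, hFspec⟩ := Extract.extract_codeFP
  refine ⟨F, hF, fun w => ?_⟩
  rw [Extract.genPQ_eq_rawE, hFspec]
  show encodeNat _ = encodeNat _
  congr 1
  unfold bigProd
  -- block length, number of blocks, full blocks
  set n := pqParams.nOf w.length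
  set t := pqParams.T n
  have hM : n * t ≤ w.length := Yao.M_nOf_le pqParams w.length
  have hblk : ∀ j, j < t → (Yao.blk n j w).length = n := fun j hj =>
    Yao.length_blk_of_le ((Nat.mul_le_mul_right n hj).trans (by rw [Nat.mul_comm]; exact hM))
  -- the kept items are the padded block images
  dsimp only
  rw [List.length_append, List.length_singleton, Nat.add_sub_cancel,
    List.take_left' rfl]
  unfold Yao.Params.comps
  rw [List.map_map]
  congr 1
  refine List.map_congr_left fun j hj => ?_
  rw [List.mem_range] at hj
  rw [Function.comp_apply, pqParams_f]
  exact Extract.val_pad_fPQ _ (hblk j hj)
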